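import Summits.BirchSwinnertonDyer.BirchSwinnertonDyer.Theorems.CyclotomicUntwistGNineKernelGeneric
import Summits.BirchSwinnertonDyer.Rank1Residual.Additive.WildThreeKrausCells
import HarnessLib

/-!
# (G₉) toolkit: ninth roots of unity at a place above `3`, and explicit cubic models

Helper file (theorems only, no definitions, no named fact) for the FIRST LEMMA `GNineCriterion`
of route `CyclotomicUntwist` (crux `PSRankOneLowerHalfAtThree`, stub `stub_gNineCriterion`): on
the wild cell at `3`, a globally minimal `E/ℚ` whose minimal discriminant is a `3`-adic square
acquires good reduction above `3` over `ℚ(ζ₉)` (the tree's `TypeGNine`). That proof is by EXPLICIT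
good-reduction models over a number field `F` containing a primitive ninth root of unity `ζ`, at
any finite place `w` of `F` with `3 ∈ w`; this file supplies the arithmetic it needs. Throughout
`ϖ = 1 − ζ` and `θ = 1 − 3ϖ + 6ϖ² − 7ϖ³ + 5ϖ⁴ − 2ϖ⁵` (spelled out; `Φ₉(1 − X) = X⁶ + 3θ(X)`):

* `zeta_rel` : `ζ⁶ + ζ³ + 1 = 0`; `varpi_pow_six` : `ϖ⁶ = −3θ`; `sigma_sq` : `(2ζ³ + 1)² = −3`;
* valuations at `w`: `w(ζ) = 1`, `w(p(ζ)) ≤ 1` for `p ∈ ℤ[X]`, `w(3) < 1`, `w(ϖ) < 1`, `w(θ) = 1`,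
  `w(D) = 1` for an integer `D` prime to `3`, division by a `w`-unit;
* the cubic model `⟨0, A₂, 0, A₄, A₆⟩` (`y² = x³ + A₂x² + A₄x + A₆`): the action of a change of
  variables `(u, r, 0, 0)` and the good-reduction test `hasGoodReductionAt_cubic_of_model`
  (transformed coefficients of valuation `≤ 1`, transformed discriminant of valuation `1`; via the
  tree's `hasGoodReductionAt_of_valuation_le_one_of_valuation_Δ_eq_one` and
  `hasGoodReductionAt_smul_iff_holds`).

Companion of `CyclotomicUntwistGNineKernelGeneric.lean` (generic translate/scale kernel and place
data, whose `val_intCast_le` is reused here). References: L. Washington, *Introduction to Cyclotomic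
Fields*, Lemma 1.4, Prop. 2.3 (`(1 − ζ₉)⁶ ∼ 3`); J. H. Silverman, *AEC* VII.1.1, VII.5.1.
-/

set_option linter.dupNamespace false

noncomputable section

open scoped NumberField Polynomial

open WeierstrassCurve IsDedekindDomain NumberField Polynomial

namespace Summit.BirchSwinnertonDyer.BirchSwinnertonDyer.Theorems.GNine

variable {F : Type*} [Field F] {ζ : F}

/-! ### The ninth cyclotomic relation and its consequences -/

/-- The ninth cyclotomic relation `ζ⁶ + ζ³ + 1 = 0` for a primitive ninth root of unity.
[folklore] -/
theorem zeta_rel (hζ : IsPrimitiveRoot ζ 9) : ζ ^ 6 + ζ ^ 3 + 1 = 0 := by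
  have h9 : ζ ^ 9 = 1 := hζ.pow_eq_one
  have h3 : ζ ^ 3 ≠ 1 := hζ.pow_ne_one_of_pos_of_lt (by norm_num) (by norm_num)
  have hfac : (ζ ^ 3 - 1) * (ζ ^ 6 + ζ ^ 3 + 1) = 0 := by
    linear_combination h9
  rcases mul_eq_zero.mp hfac with h | h
  · exact absurd (sub_eq_zero.mp h) h3
  · exact h

/-- `ϖ⁶ = −3θ` for `ϖ = 1 − ζ`, `θ = 1 − 3ϖ + 6ϖ² − 7ϖ³ + 5ϖ⁴ − 2ϖ⁵` (Washington, *Cyclotomic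
Fields*, Lemma 1.4: `(1 − ζ₉)⁶` is `3` times a unit; here the unit is made explicit).
[folklore] -/
theorem varpi_pow_six (hζ : IsPrimitiveRoot ζ 9) :
    (1 - ζ) ^ 6 = -3 * (1 - 3 * (1 - ζ) + 6 * (1 - ζ) ^ 2 - 7 * (1 - ζ) ^ 3 + 5 * (1 - ζ) ^ 4
      - 2 * (1 - ζ) ^ 5) := by
  have h := zeta_rel hζ
  linear_combination h

/-- `σ² = −3` for `σ = 2ζ³ + 1` (`ζ³` is a primitive cube root of unity). [folklore] -/
theorem sigma_sq (hζ : IsPrimitiveRoot ζ 9) : (2 * ζ ^ 3 + 1) ^ 2 = -3 := by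
  have h := zeta_rel hζ
  linear_combination (4 : F) * h

/-- `ϖ = 1 − ζ ≠ 0`. [folklore] -/
theorem one_sub_zeta_ne_zero (hζ : IsPrimitiveRoot ζ 9) : (1 - ζ : F) ≠ 0 := by
  intro h
  exact hζ.ne_one (by norm_num) (sub_eq_zero.mp h).symm

/-- `σ = 2ζ³ + 1 ≠ 0` in characteristic `0`. [folklore] -/
theorem sigma_ne_zero [CharZero F] (hζ : IsPrimitiveRoot ζ 9) : (2 * ζ ^ 3 + 1 : F) ≠ 0 := by
  intro h
  have h2 := sigma_sq hζ
  rw [h, zero_pow two_ne_zero] at h2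
  norm_num at h2

/-! ### Valuations at a finite place, and at a place above `3` -/

section Val

variable [NumberField F] (w : HeightOneSpectrum (𝓞 F))

/-- A natural number has `w`-valuation `≤ 1`. [folklore] -/
theorem val_natCast_le_one (n : ℕ) : w.valuation F (n : F) ≤ 1 := by
  simpa using w.valuation_le_one (K := F) (n : 𝓞 F)

/-- A root of unity is a `w`-unit: `w(ζ) = 1`. [folklore] -/
theorem val_zeta_eq_one (hζ : IsPrimitiveRoot ζ 9) : w.valuation F ζ = 1 := by
  have h : w.valuation F ζ ^ 9 = 1 := by rw [← map_pow, hζ.pow_eq_one, map_one]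
  exact (pow_eq_one_iff_of_nonneg zero_le (by norm_num)).mp h

/-- Every `ℤ`-polynomial expression in `ζ` has `w`-valuation `≤ 1`. [folklore] -/
theorem val_aeval_le_one (hζ : IsPrimitiveRoot ζ 9) (p : ℤ[X]) :
    w.valuation F (aeval ζ p) ≤ 1 := by
  induction p using Polynomial.induction_on' with
  | add p q hp hq =>
    rw [map_add]
    exact Valuation.map_add_le _ hp hq
  | monomial n a =>
    rw [aeval_monomial, map_mul, map_pow, val_zeta_eq_one w hζ, one_pow, mul_one,
      algebraMap_int_eq, eq_intCast]
    exact GNineCriterion.val_intCast_le w a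

/-- `w(1 − ζ) ≤ 1`. [folklore] -/
theorem val_one_sub_zeta_le_one (hζ : IsPrimitiveRoot ζ 9) : w.valuation F (1 - ζ) ≤ 1 :=
  Valuation.map_sub_le _ (by rw [map_one]) (val_zeta_eq_one w hζ).le

omit [NumberField F] in
/-- `a ≤ 1`, `b < 1` ⟹ `a·b < 1` in the value group. [folklore] -/
theorem mul_lt_one_of_le_of_lt' {a b : WithZero (Multiplicative ℤ)} (ha : a ≤ 1) (hb : b < 1) :
    a * b < 1 :=
  calc a * b ≤ 1 * b := by gcongr
    _ = b := one_mul b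
    _ < 1 := hb

/-- A natural number lying in `w` has `w`-valuation `< 1`. [folklore] -/
theorem val_natCast_lt_one_of_mem {q : ℕ} (hq : (q : 𝓞 F) ∈ w.asIdeal) :
    w.valuation F (q : F) < 1 := by
  simpa using (w.valuation_lt_one_iff_mem (K := F) (q : 𝓞 F)).mpr hq

/-- Division by a power of a `w`-unit: if `x·θᵏ = y` with `w(θ) = 1` and `w(y) ≤ 1` then
`w(x) ≤ 1`. [folklore] -/
theorem val_le_one_of_mul_unit_pow {θ : F} (hθ : w.valuation F θ = 1) {x y : F} (k : ℕ)
    (h : x * θ ^ k = y) (hy : w.valuation F y ≤ 1) : w.valuation F x ≤ 1 := by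
  have : w.valuation F x = w.valuation F y := by
    rw [← h, map_mul, map_pow, hθ, one_pow, mul_one]
  rw [this]; exact hy

/-- Division by a power of a `w`-unit: if `x·θᵏ = y` with `w(θ) = 1` and `w(y) = 1` then
`w(x) = 1`. [folklore] -/
theorem val_eq_one_of_mul_unit_pow {θ : F} (hθ : w.valuation F θ = 1) {x y : F} (k : ℕ)
    (h : x * θ ^ k = y) (hy : w.valuation F y = 1) : w.valuation F x = 1 := by
  rw [← hy, ← h, map_mul, map_pow, hθ, one_pow, mul_one]

variable (hw : (3 : 𝓞 F) ∈ w.asIdeal)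
include hw

/-- At a place above `3`: `w(3) < 1`. [folklore] -/
theorem val_three_lt_one : w.valuation F (3 : F) < 1 := by
  have h := val_natCast_lt_one_of_mem w (q := 3) (by simpa using hw)
  simpa using h

/-- At a place above `3`: `w(1 − ζ) < 1` (as `(1 − ζ)⁶ = −3θ`). [folklore] -/
theorem val_one_sub_zeta_lt_one (hζ : IsPrimitiveRoot ζ 9) : w.valuation F (1 - ζ) < 1 := by
  by_contra h
  have h1 : w.valuation F (1 - ζ) = 1 := le_antisymm (val_one_sub_zeta_le_one w hζ) (not_lt.mp h)
  have h6 : w.valuation F ((1 - ζ) ^ 6) = 1 := by rw [map_pow, h1, one_pow]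
  rw [varpi_pow_six hζ, map_mul, Valuation.map_neg] at h6
  have hθ : w.valuation F (1 - 3 * (1 - ζ) + 6 * (1 - ζ) ^ 2 - 7 * (1 - ζ) ^ 3
      + 5 * (1 - ζ) ^ 4 - 2 * (1 - ζ) ^ 5 : F) ≤ 1 := by
    have e : (1 - 3 * (1 - ζ) + 6 * (1 - ζ) ^ 2 - 7 * (1 - ζ) ^ 3 + 5 * (1 - ζ) ^ 4
        - 2 * (1 - ζ) ^ 5 : F) = aeval ζ (1 - 3 * (1 - X) + 6 * (1 - X) ^ 2 - 7 * (1 - X) ^ 3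
        + 5 * (1 - X) ^ 4 - 2 * (1 - X) ^ 5 : ℤ[X]) := by
      simp only [map_sub, map_add, map_mul, map_pow, map_one, aeval_X, map_ofNat]
    rw [e]; exact val_aeval_le_one w hζ _
  have hlt : w.valuation F (3 : F) * w.valuation F (1 - 3 * (1 - ζ) + 6 * (1 - ζ) ^ 2
      - 7 * (1 - ζ) ^ 3 + 5 * (1 - ζ) ^ 4 - 2 * (1 - ζ) ^ 5 : F) < 1 := by
    rw [mul_comm]; exact mul_lt_one_of_le_of_lt' hθ (val_three_lt_one w hw)
  exact absurd h6 hlt.ne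

/-- At a place above `3`: `θ = 1 − 3ϖ + 6ϖ² − 7ϖ³ + 5ϖ⁴ − 2ϖ⁵` is a `w`-unit (it is
`1 − ϖ·(3 − 6ϖ + 7ϖ² − 5ϖ³ + 2ϖ⁴)` with `w(ϖ) < 1`). [folklore] -/
theorem val_theta_eq_one (hζ : IsPrimitiveRoot ζ 9) :
    w.valuation F (1 - 3 * (1 - ζ) + 6 * (1 - ζ) ^ 2 - 7 * (1 - ζ) ^ 3 + 5 * (1 - ζ) ^ 4
      - 2 * (1 - ζ) ^ 5 : F) = 1 := by
  have e : (1 - 3 * (1 - ζ) + 6 * (1 - ζ) ^ 2 - 7 * (1 - ζ) ^ 3 + 5 * (1 - ζ) ^ 4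
      - 2 * (1 - ζ) ^ 5 : F) = 1 - (1 - ζ) * (3 - 6 * (1 - ζ) + 7 * (1 - ζ) ^ 2 - 5 * (1 - ζ) ^ 3
      + 2 * (1 - ζ) ^ 4) := by ring
  rw [e]
  apply Valuation.map_one_sub_of_lt
  rw [map_mul, mul_comm]
  refine mul_lt_one_of_le_of_lt' ?_ (val_one_sub_zeta_lt_one w hw hζ)
  have e' : (3 - 6 * (1 - ζ) + 7 * (1 - ζ) ^ 2 - 5 * (1 - ζ) ^ 3 + 2 * (1 - ζ) ^ 4 : F) =
      aeval ζ (3 - 6 * (1 - X) + 7 * (1 - X) ^ 2 - 5 * (1 - X) ^ 3 + 2 * (1 - X) ^ 4 : ℤ[X]) := by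
    simp only [map_sub, map_add, map_mul, map_pow, map_one, aeval_X, map_ofNat]
  rw [e']; exact val_aeval_le_one w hζ _

/-- At a place above `3`: `θ ≠ 0`. [folklore] -/
theorem theta_ne_zero (hζ : IsPrimitiveRoot ζ 9) :
    (1 - 3 * (1 - ζ) + 6 * (1 - ζ) ^ 2 - 7 * (1 - ζ) ^ 3 + 5 * (1 - ζ) ^ 4
      - 2 * (1 - ζ) ^ 5 : F) ≠ 0 := by
  intro h
  have := val_theta_eq_one w hw hζ
  rw [h, map_zero] at this
  exact zero_ne_one this

/-- An integer prime to `3` is a `w`-unit at a place above `3`. [folklore] -/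
theorem val_intCast_eq_one_of_not_dvd {D : ℤ} (hD : ¬ (3 : ℤ) ∣ D) :
    w.valuation F (D : F) = 1 := by
  refine le_antisymm (GNineCriterion.val_intCast_le w D) (not_lt.mp fun hlt ↦ ?_)
  have hcop : IsCoprime (3 : ℤ) D :=
    (Irreducible.coprime_iff_not_dvd Int.prime_three.irreducible).mpr hD
  obtain ⟨a, b, hab⟩ := hcop
  have h1 : w.valuation F ((a : F) * 3 + (b : F) * D) < 1 := by
    refine lt_of_le_of_lt (Valuation.map_add _ _ _) (max_lt ?_ ?_)
    · rw [map_mul]; exact mul_lt_one_of_le_of_lt' (GNineCriterion.val_intCast_le w a) (val_three_lt_one w hw)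
    · rw [map_mul]; exact mul_lt_one_of_le_of_lt' (GNineCriterion.val_intCast_le w b) hlt
  have h2 : ((a : F) * 3 + (b : F) * D) = 1 := by exact_mod_cast hab
  rw [h2, map_one] at h1
  exact lt_irrefl _ h1

/-- A natural number prime to `3` is a `w`-unit at a place above `3`. [folklore] -/
theorem val_natCast_eq_one_of_not_dvd {D : ℕ} (hD : ¬ 3 ∣ D) : w.valuation F (D : F) = 1 := by
  have h := val_intCast_eq_one_of_not_dvd w hw (D := (D : ℤ)) (by exact_mod_cast hD)
  simpa using h

end Val

/-! ### The cubic model `y² = x³ + A₂x² + A₄x + A₆` -/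

/-- `Δ(y² = x³ + A₂x² + A₄x + A₆) = 16·disc(x³ + A₂x² + A₄x + A₆)` over any commutative ring.
[folklore] -/
theorem cubic_Δ {R : Type*} [CommRing R] (A₂ A₄ A₆ : R) :
    (⟨0, A₂, 0, A₄, A₆⟩ : WeierstrassCurve R).Δ =
      16 * (-4 * A₂ ^ 3 * A₆ + A₂ ^ 2 * A₄ ^ 2 + 18 * A₂ * A₄ * A₆ - 4 * A₄ ^ 3 - 27 * A₆ ^ 2) := by
  simp only [WeierstrassCurve.Δ, WeierstrassCurve.b₂, WeierstrassCurve.b₄,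
    WeierstrassCurve.b₆, WeierstrassCurve.b₈]
  ring

/-- `c₄(y² = x³ + A₂x² + A₄x + A₆) = 16·(A₂² − 3A₄)` over any commutative ring. [folklore] -/
theorem cubic_c₄ {R : Type*} [CommRing R] (A₂ A₄ A₆ : R) :
    (⟨0, A₂, 0, A₄, A₆⟩ : WeierstrassCurve R).c₄ = 16 * (A₂ ^ 2 - 3 * A₄) := by
  simp only [WeierstrassCurve.c₄, WeierstrassCurve.b₂, WeierstrassCurve.b₄]
  ring

/-- The cubic model is preserved by ring maps. [folklore] -/
theorem cubic_map {R S : Type*} [CommRing R] [CommRing S] (f : R →+* S) (A₂ A₄ A₆ : R) :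
    (⟨0, A₂, 0, A₄, A₆⟩ : WeierstrassCurve R).map f = ⟨0, f A₂, 0, f A₄, f A₆⟩ := by
  simp only [WeierstrassCurve.map, map_zero]

/-- `(u, r, 0, 0) • (y² = x³ + A₂x² + A₄x + A₆)` is the cubic model with coefficients
`(A₂ + 3r)/u²`, `(A₄ + 2rA₂ + 3r²)/u⁴`, `(A₆ + rA₄ + r²A₂ + r³)/u⁶`. [folklore] -/
theorem chg_smul_cubic (u : F) (hu : u ≠ 0) (r A₂ A₄ A₆ : F) :
    (⟨Units.mk0 u hu, r, 0, 0⟩ : VariableChange F) • (⟨0, A₂, 0, A₄, A₆⟩ : WeierstrassCurve F) =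
      ⟨0, u⁻¹ ^ 2 * (A₂ + 3 * r), 0, u⁻¹ ^ 4 * (A₄ + 2 * r * A₂ + 3 * r ^ 2),
        u⁻¹ ^ 6 * (A₆ + r * A₄ + r ^ 2 * A₂ + r ^ 3)⟩ := by
  have hinv : (↑(Units.mk0 u hu)⁻¹ : F) = u⁻¹ := by rw [Units.val_inv_eq_inv_val, Units.val_mk0]
  rw [variableChange_def]
  simp only [hinv, WeierstrassCurve.mk.injEq]
  refine ⟨?_, ?_, ?_, ?_, ?_⟩ <;> ring

/-- The discriminant after `(u, r, 0, 0)`: `Δ' = u⁻¹² Δ`. [folklore] -/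
theorem chg_smul_cubic_Δ (u : F) (hu : u ≠ 0) (r A₂ A₄ A₆ : F) :
    (⟨0, u⁻¹ ^ 2 * (A₂ + 3 * r), 0, u⁻¹ ^ 4 * (A₄ + 2 * r * A₂ + 3 * r ^ 2),
        u⁻¹ ^ 6 * (A₆ + r * A₄ + r ^ 2 * A₂ + r ^ 3)⟩ : WeierstrassCurve F).Δ =
      u⁻¹ ^ 12 * (⟨0, A₂, 0, A₄, A₆⟩ : WeierstrassCurve F).Δ := by
  rw [← chg_smul_cubic u hu, variableChange_Δ, Units.val_inv_eq_inv_val, Units.val_mk0]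

section Good

variable [NumberField F] (w : HeightOneSpectrum (𝓞 F))

/-- Good reduction of a cubic model whose coefficients have valuation `≤ 1` and whose
discriminant is a `w`-unit (Silverman *AEC* VII.5.1(a), VII.1.1; the tree's
`hasGoodReductionAt_of_valuation_le_one_of_valuation_Δ_eq_one`). [folklore] -/
theorem hasGoodReductionAt_cubic_of_val (A₂ A₄ A₆ : F) (h₂ : w.valuation F A₂ ≤ 1)
    (h₄ : w.valuation F A₄ ≤ 1) (h₆ : w.valuation F A₆ ≤ 1)
    (hΔ : w.valuation F (⟨0, A₂, 0, A₄, A₆⟩ : WeierstrassCurve F).Δ = 1) :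
    (⟨0, A₂, 0, A₄, A₆⟩ : WeierstrassCurve F).HasGoodReductionAt w :=
  hasGoodReductionAt_of_valuation_le_one_of_valuation_Δ_eq_one w _
    (by rw [map_zero]; exact zero_le) h₂ (by rw [map_zero]; exact zero_le) h₄ h₆ hΔ

/-- Transport of good reduction along `(u, r, 0, 0)`: if the transformed cubic has good reduction
at `w`, so does the original (the tree's `hasGoodReductionAt_smul_iff_holds`, Silverman *AEC*
VII.5.1). [folklore] -/
theorem hasGoodReductionAt_cubic_of_chg (u : F) (hu : u ≠ 0) (r A₂ A₄ A₆ : F)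
    (h : (⟨0, u⁻¹ ^ 2 * (A₂ + 3 * r), 0, u⁻¹ ^ 4 * (A₄ + 2 * r * A₂ + 3 * r ^ 2),
        u⁻¹ ^ 6 * (A₆ + r * A₄ + r ^ 2 * A₂ + r ^ 3)⟩ : WeierstrassCurve F).HasGoodReductionAt w) :
    (⟨0, A₂, 0, A₄, A₆⟩ : WeierstrassCurve F).HasGoodReductionAt w := by
  rw [← chg_smul_cubic u hu] at h
  exact (hasGoodReductionAt_smul_iff_holds w _ _).mp h

/-- **Good-reduction test for the cubic model.** If after the change of variables `(u, r, 0, 0)`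
the three coefficients have `w`-valuation `≤ 1` and the discriminant `u⁻¹²Δ` has `w`-valuation
`1`, then `y² = x³ + A₂x² + A₄x + A₆` has good reduction at `w`. [folklore] -/
theorem hasGoodReductionAt_cubic_of_model (u : F) (hu : u ≠ 0) (r A₂ A₄ A₆ : F)
    (h₂ : w.valuation F (u⁻¹ ^ 2 * (A₂ + 3 * r)) ≤ 1)
    (h₄ : w.valuation F (u⁻¹ ^ 4 * (A₄ + 2 * r * A₂ + 3 * r ^ 2)) ≤ 1)
    (h₆ : w.valuation F (u⁻¹ ^ 6 * (A₆ + r * A₄ + r ^ 2 * A₂ + r ^ 3)) ≤ 1)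
    (hΔ : w.valuation F (u⁻¹ ^ 12 * (⟨0, A₂, 0, A₄, A₆⟩ : WeierstrassCurve F).Δ) = 1) :
    (⟨0, A₂, 0, A₄, A₆⟩ : WeierstrassCurve F).HasGoodReductionAt w := by
  refine hasGoodReductionAt_cubic_of_chg w u hu r A₂ A₄ A₆
    (hasGoodReductionAt_cubic_of_val w _ _ _ h₂ h₄ h₆ ?_)
  rw [chg_smul_cubic_Δ u hu]
  exact hΔ

end Good

end Summit.BirchSwinnertonDyer.BirchSwinnertonDyer.Theorems.GNine

end
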